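import Mathlib
import HarnessLib
import Summits.ValiantsHypothesis.ValiantsHypothesis.Theses.MonotoneRestoration
import Literature.Computability.AlgebraicComplexity.SymmetricCircuitConstOutputs

/-! # Route MonotoneRestoration — crux `MonotoneRestorationQP`, line Sketch, stub Z8
(stmt-ValiantsHypothesis-15886)

**Invariant constant families are symmetrically computable.** For any group `Γ` acting on the
variables `X` and on a finite index set `Y`, a `Γ`-invariant family of constants `c : Y → K`
(`c (γ • y) = c y`; e.g. the identity matrix `(δ_ij)_{ij}`, the all-ones matrix, a constant
diagonal) is computed — as the family of constant polynomials `(C (c y))_{y ∈ Y}` at outputs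
indexed by `Y` — by a `Γ`-symmetric Dawar–Wilsenach labelled arithmetic circuit over `K`, `X` on
at most `2 |Y|` gates.

Proof: the universe-`0` instance of the tree lemma `LabelledArithCircuit.exists_constOutputs`
(`Literature/Computability/AlgebraicComplexity/SymmetricCircuitConstOutputs.lean`): gate set
`↥(Set.range c) ⊕ Y`, one constant gate per VALUE of `c` (so that distinct input gates carry
distinct labels) and one unary `+` copy gate per index `y` over the constant gate with value
`c y`, which is the output `y`; `γ` extends as the automorphism `id ⊕ (γ • ·)` because
`c (γ • y) = c y`; size `|Set.range c| + |Y| ≤ 2 |Y|`.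
-/

noncomputable section

-- `Summit.ValiantsHypothesis.ValiantsHypothesis.…` is the tree's mandated namespace (Sub = Summit).
set_option linter.dupNamespace false

namespace Summit.ValiantsHypothesis.ValiantsHypothesis.Theorems

open Literature.Computability.AlgebraicComplexity

/-- **Z8 — invariant constant families** (crux `MonotoneRestorationQP`, line Sketch; registered
stub `stub_symmetric_constOutputs`): for a `Γ`-invariant family of constants `c : Y → K` on a
finite `Γ`-set `Y`, some `Γ`-symmetric labelled circuit over `K`, `X` with outputs indexed by `Y`
computes the constant polynomial `C (c y)` at the output `y`, on at most `2 |Y|` gates (one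
constant gate per value of `c`, one unary `+` copy gate per index). Instance of
`LabelledArithCircuit.exists_constOutputs`. -/
theorem stub_symmetric_constOutputs {K X Y Γ : Type} [CommSemiring K] [Group Γ] [MulAction Γ X]
    [MulAction Γ Y] [Fintype Y] (c : Y → K) (hc : ∀ (γ : Γ) (y : Y), c (γ • y) = c y) :
    ∃ (G : Type) (_ : Fintype G) (C : LabelledArithCircuit K X Y G),
      C.IsSymmetric Γ ∧
      (∀ y, C.eval (C.output y) = MvPolynomial.C (c y)) ∧
      Fintype.card G ≤ 2 * Fintype.card Y :=
  LabelledArithCircuit.exists_constOutputs X c hc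

end Summit.ValiantsHypothesis.ValiantsHypothesis.Theorems

end
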